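import Summits.AtomisticToContinuum.Crystallization.Theorems.ChartedZeroExcessLayeredLatticeLiouvilleZZK

/-!
# (B′.3c) rider ZZL — THE DICTIONARY, PART II: the second shell, WITHOUT metric margins

Lineage `stmt-AtomisticToContinuum-26636` (route ChartedPlanarOrder), lens-2 g80, cone-pin programme (B′) for (L2-S) at record dials.  Part I (rider
ZZK) placed the twelve LINK atoms of a charted clean atom `Ψ x` at `Ψ x + a • F (iotaPt i) ± a/16`.  This part places the SECOND SHELL: for every
orthogonal pair of link codes `(i, j)` (`ιᵢ · ιⱼ = 0`; these are exactly the hex–cap pairs, and `ιᵢ + ιⱼ` runs over the six second-shell vectors),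
the charted atom `Ψ (linkPt τ (linkPt τ x i) j)` sits at `Ψ x + a • F (iotaPt i + iotaPt j) ± a/16` (`secondShell_frame`, rider ZZM —
this file carries the index facts §ZZL-1/2 and the metric CONFUSION LEMMA §ZZL-3 it rests on).

## Why this is not a metric statement
A pattern-adjacent pair of atoms may be up to `a(1 + 1/8) = 1.125 > 28/25` apart, so «pattern contact ⇒ chart bond» FAILS at tolerance `1/16`,
and the genuine second-shell pattern atom `g` of `Ψ x` cannot be identified with the charted site through bonds.  Instead (§ZZL-3, the CONFUSION
LEMMA `eq_of_common_contacts`): the charted atom `y = Ψ z`, `z = linkPt (linkPt x i) j`, is chart-bonded to the clean link atom `m = Ψ (linkPt x i)`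
and to the two other corners `P, Q` of the contact square under `z` (index facts, §ZZL-1, by `decide`); `g` is within `9a/8` of `m, P, Q` (frame of
`x`); in the CLEAN PATTERN OF `m` the atoms `Ψ x, y, g` are therefore three common contacts of the two distinct first-shell vectors labelling `P, Q`
— and a pair of distinct first-shell vectors of the fcc / hcp model has AT MOST TWO common contacts (`decide`).  Since `Ψ x ≠ y` and `Ψ x ≠ g`,
`y = g`.  Only quantised thresholds occur: `9/8` against `a·{1, √2}` with `a ≥ 9/10`, tolerance `a/16`; no two scales are ever compared.

0 sorry.  Consumer: the (c1)/(c2) packaging of the pin step ((B′.5)): second-shell MEMBERS of a certificate cell are sites `linkPt (linkPt x i) j`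
with `ιᵢ · ιⱼ = 0`, so their atoms lie in the `11/20`-cones of rider ZZE `member_cone_second` around `F (ιᵢ + ιⱼ)`.
-/

open scoped RealInnerProductSpace
open Literature.Geometry.DiscreteGeometry (intVec intVec_apply norm_intVec sqNormInt dotInt refPt IsRealization fccInt hcpInt
  fccSecondShellInt hcpSecondShellInt fccTwoShellPattern hcpTwoShellPattern scaledPattern IsTwoShellGoodSet intVec_add)

namespace Summit.AtomisticToContinuum.Crystallization.Theorems.ChartedZeroExcessLayeredLatticeLiouville

open Summit.AtomisticToContinuum.Crystallization.Theorems.ChartedPlanarOrderRigidityDoor (E3)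

/-! ## ZZL-1  Index facts (decide) -/

/-- the second-shell site over an orthogonal pair `(i, j)` — reached as code `j` from the link site of code `i` — is Barlow-adjacent to every CORNER
`p` (a code in contact with both `i` and `j`), in every letter context. [this file, g80] -/
theorem cornerAdjB_dec : ∀ a b c d : Bool, ∀ i j p : Fin 12,
    dotInt (iotaTab b c i) (iotaTab b c j) = 0 → dotInt (iotaTab b c p) (iotaTab b c i) = 9 → dotInt (iotaTab b c p) (iotaTab b c j) = 9 →
      barlowAdjB (letters4 a b c d) (linkPt (letters4 a b c d) 0 p)
        (linkPt (letters4 a b c d) (linkPt (letters4 a b c d) 0 i) j) = true := by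
  decide +kernel

/-- the second-shell site over an orthogonal pair is not the centre. [this file, g80] -/
theorem twoStep_ne_zero_dec : ∀ a b c d : Bool, ∀ i j : Fin 12, dotInt (iotaTab b c i) (iotaTab b c j) = 0 →
    linkPt (letters4 a b c d) (linkPt (letters4 a b c d) 0 i) j ≠ 0 := by
  decide +kernel

/-- a code in contact (`dot = 9`) with code `i` is coded-adjacent to it. [this file, g80] -/
theorem linkAdj_of_dot9 : ∀ α β : Bool, ∀ i p : Fin 12, dotInt (iotaTab α β p) (iotaTab α β i) = 9 → linkAdj α β i p = true := by decide

/-- every orthogonal pair of codes has two distinct corners. [this file, g80] -/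
theorem exists_corners : ∀ α β : Bool, ∀ i j : Fin 12, dotInt (iotaTab α β i) (iotaTab α β j) = 0 →
    ∃ p q : Fin 12, p ≠ q ∧ dotInt (iotaTab α β p) (iotaTab α β i) = 9 ∧ dotInt (iotaTab α β p) (iotaTab α β j) = 9 ∧
      dotInt (iotaTab α β q) (iotaTab α β i) = 9 ∧ dotInt (iotaTab α β q) (iotaTab α β j) = 9 := by
  decide +kernel

/-- fcc model: the sum of an orthogonal pair of first-shell vectors is a pattern (second-shell) vector. [folklore] -/
theorem fcc_orth_sum : ∀ s ∈ fccInt ∪ fccSecondShellInt, ∀ t ∈ fccInt ∪ fccSecondShellInt,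
    sqNormInt s = 2 → sqNormInt t = 2 → dotInt s t = 0 → s + t ∈ fccInt ∪ fccSecondShellInt := by decide

/-- hcp model: the sum of an orthogonal pair of first-shell vectors is a pattern (second-shell) vector. [folklore] -/
theorem hcp_orth_sum : ∀ s ∈ hcpInt ∪ hcpSecondShellInt, ∀ t ∈ hcpInt ∪ hcpSecondShellInt,
    sqNormInt s = 18 → sqNormInt t = 18 → dotInt s t = 0 → s + t ∈ hcpInt ∪ hcpSecondShellInt := by decide

/-- fcc model: two distinct first-shell vectors have at most two common first-shell contacts. [folklore] -/
theorem fcc_common_contacts : ∀ u ∈ fccInt ∪ fccSecondShellInt, ∀ v ∈ fccInt ∪ fccSecondShellInt,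
    sqNormInt u = 2 → sqNormInt v = 2 → u ≠ v →
      ((fccInt ∪ fccSecondShellInt).filter fun t => sqNormInt t = 2 ∧ 2 * dotInt t u = 2 ∧ 2 * dotInt t v = 2).card ≤ 2 := by
  decide

/-- hcp model: two distinct first-shell vectors have at most two common first-shell contacts. [folklore] -/
theorem hcp_common_contacts : ∀ u ∈ hcpInt ∪ hcpSecondShellInt, ∀ v ∈ hcpInt ∪ hcpSecondShellInt,
    sqNormInt u = 18 → sqNormInt v = 18 → u ≠ v →
      ((hcpInt ∪ hcpSecondShellInt).filter fun t => sqNormInt t = 18 ∧ 2 * dotInt t u = 18 ∧ 2 * dotInt t v = 18).card ≤ 2 := by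
  decide

/-! ## ZZL-2  Index bookkeeping: two-step sites in a general chart -/

/-- translating the centre translates the coded link (letters re-based). [formal bookkeeping] -/
theorem linkPt_add (τ : ℤ → Bool) (x y : ℤ × ℤ × ℤ) (j : Fin 12) :
    linkPt τ (x + y) j = x + linkPt (fun m => τ (x.1 + m)) y j := by
  obtain ⟨k, c⟩ := x
  obtain ⟨n, p⟩ := y
  simp only [linkPt, shiftSite, Prod.mk_add_mk, add_assoc, add_sub_assoc]

/-- [formal bookkeeping] -/
theorem linkPt_eq_add (τ : ℤ → Bool) (x : ℤ × ℤ × ℤ) (j : Fin 12) : linkPt τ x j = x + linkPt (fun m => τ (x.1 + m)) 0 j := by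
  simpa using linkPt_add τ x 0 j

/-- the coded link of a site on sheets `−1 … 1` reads the letters on `{−2, …, 1}` only. [formal bookkeeping] -/
theorem linkPt_letters_congr {ℓ ℓ' : ℤ → Bool} (h : ∀ m : ℤ, -2 ≤ m → m ≤ 1 → ℓ m = ℓ' m) (y : ℤ × ℤ × ℤ)
    (hy : -1 ≤ y.1) (hy2 : y.1 ≤ 1) (j : Fin 12) : linkPt ℓ y j = linkPt ℓ' y j := by
  simp only [linkPt]
  rw [h (y.1 - 1) (by omega) (by omega), h y.1 (by omega) (by omega)]

/-- sheets of coded link sites. [formal bookkeeping] -/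
theorem linkPt_fst_bounds (ℓ : ℤ → Bool) (y : ℤ × ℤ × ℤ) (j : Fin 12) : y.1 - 1 ≤ (linkPt ℓ y j).1 ∧ (linkPt ℓ y j).1 ≤ y.1 + 1 := by
  rw [linkPt_fst]
  rcases linkSite_fst (ℓ (y.1 - 1)) (ℓ y.1) j with h | h | h <;> rw [h] <;> constructor <;> omega

/-- ★ INDEX SQUARE: in any chart, the two-step site `linkPt τ (linkPt τ x i) j` over an orthogonal pair `(i, j)` is Barlow-adjacent to the link site of
every corner code `p`. [this file, g80] -/
theorem barlowAdj_corner (τ : ℤ → Bool) (x : ℤ × ℤ × ℤ) {i j p : Fin 12}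
    (h0 : dotInt (iotaTab (τ (x.1 - 1)) (τ x.1) i) (iotaTab (τ (x.1 - 1)) (τ x.1) j) = 0)
    (hpi : dotInt (iotaTab (τ (x.1 - 1)) (τ x.1) p) (iotaTab (τ (x.1 - 1)) (τ x.1) i) = 9)
    (hpj : dotInt (iotaTab (τ (x.1 - 1)) (τ x.1) p) (iotaTab (τ (x.1 - 1)) (τ x.1) j) = 9) :
    BarlowAdj τ (linkPt τ x p) (linkPt τ (linkPt τ x i) j) := by
  set ℓ : ℤ → Bool := fun m => τ (x.1 + m) with hℓ
  set L : ℤ → Bool := letters4 (τ (x.1 - 2)) (τ (x.1 - 1)) (τ x.1) (τ (x.1 + 1)) with hL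
  have hℓL : ∀ m : ℤ, -2 ≤ m → m ≤ 1 → ℓ m = L m := fun m h1 h2 => letters4_shift τ x m h1 h2
  have e1 : linkPt τ x p = x + linkPt ℓ 0 p := linkPt_eq_add τ x p
  have e2 : linkPt τ (linkPt τ x i) j = x + linkPt ℓ (linkPt ℓ 0 i) j := by rw [linkPt_eq_add τ x i, linkPt_add]
  rw [e1, e2, barlowAdj_add_iff]
  have b0 := linkPt_fst_bounds ℓ 0 i
  have b0' := linkPt_fst_bounds ℓ 0 p
  have b1 := linkPt_fst_bounds ℓ (linkPt ℓ 0 i) j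
  simp only [Prod.fst_zero] at b0 b0'
  rw [barlowAdj_letters_congr hℓL (by omega) (by omega) (by omega) (by omega),
    linkPt_letters_congr hℓL (linkPt ℓ 0 i) (by omega) (by omega), linkPt_letters_congr hℓL 0 (by simp) (by simp),
    linkPt_letters_congr hℓL 0 (by simp) (by simp), ← barlowAdjB_iff]
  have hb : ℓ (-1) = τ (x.1 - 1) := by simp [hℓ, sub_eq_add_neg]
  have hc : ℓ 0 = τ x.1 := by simp [hℓ]
  rw [← hb, ← hc] at h0 hpi hpj
  rw [hL, ← hb, ← hc, show τ (x.1 - 2) = ℓ (-2) by simp [hℓ, sub_eq_add_neg], show τ (x.1 + 1) = ℓ 1 by simp [hℓ]]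
  exact cornerAdjB_dec _ _ _ _ i j p h0 hpi hpj

/-- ★ the two-step site over an orthogonal pair is not the centre. [this file, g80] -/
theorem twoStep_ne_self (τ : ℤ → Bool) (x : ℤ × ℤ × ℤ) {i j : Fin 12}
    (h0 : dotInt (iotaTab (τ (x.1 - 1)) (τ x.1) i) (iotaTab (τ (x.1 - 1)) (τ x.1) j) = 0) :
    linkPt τ (linkPt τ x i) j ≠ x := by
  set ℓ : ℤ → Bool := fun m => τ (x.1 + m) with hℓ
  set L : ℤ → Bool := letters4 (τ (x.1 - 2)) (τ (x.1 - 1)) (τ x.1) (τ (x.1 + 1)) with hL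
  have hℓL : ∀ m : ℤ, -2 ≤ m → m ≤ 1 → ℓ m = L m := fun m h1 h2 => letters4_shift τ x m h1 h2
  have e2 : linkPt τ (linkPt τ x i) j = x + linkPt ℓ (linkPt ℓ 0 i) j := by rw [linkPt_eq_add τ x i, linkPt_add]
  have b0 := linkPt_fst_bounds ℓ 0 i
  simp only [Prod.fst_zero] at b0
  rw [e2, linkPt_letters_congr hℓL (linkPt ℓ 0 i) (by omega) (by omega), linkPt_letters_congr hℓL 0 (by simp) (by simp)]
  intro h
  have h' : linkPt L (linkPt L 0 i) j = 0 := by simpa using h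
  have hb : ℓ (-1) = τ (x.1 - 1) := by simp [hℓ, sub_eq_add_neg]
  have hc : ℓ 0 = τ x.1 := by simp [hℓ]
  rw [← hb, ← hc] at h0
  rw [hL, ← hb, ← hc, show τ (x.1 - 2) = ℓ (-2) by simp [hℓ, sub_eq_add_neg], show τ (x.1 + 1) = ℓ 1 by simp [hℓ]] at h'
  exact twoStep_ne_zero_dec _ _ _ _ i j h0 h'

/-! ## ZZL-3  The confusion lemma in one clean pattern -/

section Confusion

/-- ★★ **CONFUSION LEMMA.**  In the clean pattern (integer model `I/√N`, scale `a ≥ 9/10`, tolerance `a/16`) of an atom `m`, let `c₀, P, Q, y, g` be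
atoms within `9/8` of `m` with `P ≠ Q`, each of `c₀, y, g` within `9/8` of both `P` and `Q` (and distinct from them), and `c₀ ≠ y`, `c₀ ≠ g`.  Then
`y = g`: all five are first-shell pattern atoms of `m`, the six close pairs are pattern contacts, and two distinct first-shell vectors have at most two
common contacts. [this file, g80] -/
theorem eq_of_common_contacts {S : Set E3} {m c₀ P Q y g : E3} {I : Finset (Fin 3 → ℤ)} {N : ℕ} (hN : 0 < N)
    (hnorm : ∀ s ∈ I, sqNormInt s = N ∨ sqNormInt s = 2 * N)
    (hpos : ∀ s ∈ I, ∀ t ∈ I, sqNormInt s = N → sqNormInt t = N → 0 < dotInt s t → s = t ∨ 2 * dotInt s t = N)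
    (hcc : ∀ u ∈ I, ∀ v ∈ I, sqNormInt u = N → sqNormInt v = N → u ≠ v →
      (I.filter fun t => sqNormInt t = N ∧ 2 * dotInt t u = N ∧ 2 * dotInt t v = N).card ≤ 2)
    {a : ℝ} (ha : 9 / 10 ≤ a) {A : E3 →ₗᵢ[ℝ] E3} {f : E3 → E3}
    (hf : ∀ v ∈ scaledPattern I N, f v ∈ S ∧ dist (f v) (m + a • A v) ≤ 1 / 16 * a)
    (hcov : ∀ y ∈ S, y ≠ m → dist y m ≤ 3 / 2 * a → ∃ v ∈ scaledPattern I N, f v = y)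
    (hc₀ : c₀ ∈ S) (hP : P ∈ S) (hQ : Q ∈ S) (hy : y ∈ S) (hg : g ∈ S)
    (hc₀m : c₀ ≠ m) (hPm : P ≠ m) (hQm : Q ≠ m) (hym : y ≠ m) (hgm : g ≠ m) (hPQ : P ≠ Q)
    (hc₀P : c₀ ≠ P) (hc₀Q : c₀ ≠ Q) (hyP : y ≠ P) (hyQ : y ≠ Q) (hgP : g ≠ P) (hgQ : g ≠ Q) (hc₀y : c₀ ≠ y) (hc₀g : c₀ ≠ g)
    (dc₀ : dist c₀ m ≤ 9 / 8) (dP : dist P m ≤ 9 / 8) (dQ : dist Q m ≤ 9 / 8) (dy : dist y m ≤ 9 / 8) (dg : dist g m ≤ 9 / 8)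
    (dc₀P : dist c₀ P ≤ 9 / 8) (dc₀Q : dist c₀ Q ≤ 9 / 8) (dyP : dist y P ≤ 9 / 8) (dyQ : dist y Q ≤ 9 / 8)
    (dgP : dist g P ≤ 9 / 8) (dgQ : dist g Q ≤ 9 / 8) : y = g := by
  have hN' : (0 : ℝ) < N := by exact_mod_cast hN
  have hapos : 0 < a := by linarith
  have hnormA : ∀ v : E3, ‖a • A v‖ = a * ‖v‖ := fun v => by rw [norm_smul, Real.norm_of_nonneg hapos.le, A.norm_map]
  -- labels
  have lab : ∀ e ∈ S, e ≠ m → dist e m ≤ 9 / 8 → ∃ t ∈ I, f ((Real.sqrt N)⁻¹ • intVec t) = e := by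
    intro e he hem hd
    obtain ⟨v, hv, hfv⟩ := hcov e he hem (by linarith)
    obtain ⟨t, ht, rfl⟩ := Finset.mem_image.1 hv
    exact ⟨t, ht, hfv⟩
  have hmem : ∀ t ∈ I, (Real.sqrt N)⁻¹ • intVec t ∈ scaledPattern I N := fun t ht => Finset.mem_image_of_mem _ ht
  -- first shell: a labelled atom within 9/8 of m is a first-shell atom
  have sh1 : ∀ t ∈ I, dist (f ((Real.sqrt N)⁻¹ • intVec t)) m ≤ 9 / 8 → sqNormInt t = N := by
    intro t ht hd
    rcases hnorm t ht with h | h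
    · exact h
    exfalso
    set u : E3 := (Real.sqrt N)⁻¹ • intVec t
    have hu2 : ‖u‖ ^ 2 = 2 := by
      have hc : ((sqNormInt t : ℤ) : ℝ) = 2 * (N : ℝ) := by rw [h]; push_cast; ring
      rw [norm_scaled_sq hN, hc]; field_simp
    have hd' : a * ‖u‖ ≤ 1 / 16 * a + 9 / 8 := by
      rw [← hnormA]
      calc ‖a • A u‖ = dist (m + a • A u) m := by rw [dist_eq_norm, add_sub_cancel_left]
        _ ≤ dist (m + a • A u) (f u) + dist (f u) m := dist_triangle _ _ _
        _ ≤ 1 / 16 * a + 9 / 8 := by rw [dist_comm]; exact add_le_add (hf u (hmem t ht)).2 hd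
    have hsq : (a * ‖u‖) ^ 2 ≤ (1 / 16 * a + 9 / 8) ^ 2 := pow_le_pow_left₀ (by positivity) hd' 2
    rw [mul_pow, hu2] at hsq
    nlinarith
  -- contact: two distinct first-shell atoms within 9/8 of each other are pattern contacts
  have ct : ∀ t ∈ I, ∀ t' ∈ I, sqNormInt t = N → sqNormInt t' = N →
      f ((Real.sqrt N)⁻¹ • intVec t) ≠ f ((Real.sqrt N)⁻¹ • intVec t') →
      dist (f ((Real.sqrt N)⁻¹ • intVec t)) (f ((Real.sqrt N)⁻¹ • intVec t')) ≤ 9 / 8 → 2 * dotInt t t' = N := by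
    intro t ht t' ht' h1 h1' hne hd
    set u : E3 := (Real.sqrt N)⁻¹ • intVec t
    set u' : E3 := (Real.sqrt N)⁻¹ • intVec t'
    have hunit : ‖u‖ ^ 2 = 1 := by rw [norm_scaled_sq hN, h1]; push_cast; field_simp
    have hunit' : ‖u'‖ ^ 2 = 1 := by rw [norm_scaled_sq hN, h1']; push_cast; field_simp
    have hd' : a * ‖u - u'‖ ≤ 9 / 8 + (1 / 16 * a + 1 / 16 * a) := by
      rw [← hnormA, map_sub, smul_sub]
      calc ‖a • A u - a • A u'‖ = dist (m + a • A u) (m + a • A u') := by rw [dist_eq_norm, add_sub_add_left_eq_sub]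
        _ ≤ dist (m + a • A u) (f u) + dist (f u) (m + a • A u') := dist_triangle _ _ _
        _ ≤ 1 / 16 * a + (dist (f u) (f u') + dist (f u') (m + a • A u')) :=
            add_le_add (by rw [dist_comm]; exact (hf u (hmem t ht)).2) (dist_triangle _ _ _)
        _ ≤ 1 / 16 * a + (9 / 8 + 1 / 16 * a) := by gcongr; exact (hf u' (hmem t' ht')).2
        _ = 9 / 8 + (1 / 16 * a + 1 / 16 * a) := by ring
    have hsq : (a * ‖u - u'‖) ^ 2 ≤ (9 / 8 + (1 / 16 * a + 1 / 16 * a)) ^ 2 := pow_le_pow_left₀ (by positivity) hd' 2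
    have hexp : ‖u - u'‖ ^ 2 = 2 - 2 * ((dotInt t t' : ℝ) / N) := by
      rw [norm_sub_sq_real, hunit, hunit', inner_scaled hN]; ring
    rw [mul_pow, hexp] at hsq
    have hdpos : 0 < dotInt t t' := by
      by_contra hle
      push Not at hle
      have hle' : (dotInt t t' : ℝ) / N ≤ 0 := div_nonpos_of_nonpos_of_nonneg (by exact_mod_cast hle) hN'.le
      nlinarith
    rcases hpos t ht t' ht' h1 h1' hdpos with h | h
    · exact absurd (congrArg (fun r : Fin 3 → ℤ => f ((Real.sqrt N)⁻¹ • intVec r)) h) hne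
    · exact h
  -- the five labels
  obtain ⟨t₀, ht₀, e₀⟩ := lab c₀ hc₀ hc₀m dc₀
  obtain ⟨tP, htP, eP⟩ := lab P hP hPm dP
  obtain ⟨tQ, htQ, eQ⟩ := lab Q hQ hQm dQ
  obtain ⟨ty, hty, ey⟩ := lab y hy hym dy
  obtain ⟨tg, htg, eg⟩ := lab g hg hgm dg
  have s₀ := sh1 t₀ ht₀ (by rw [e₀]; exact dc₀)
  have sP := sh1 tP htP (by rw [eP]; exact dP)
  have sQ := sh1 tQ htQ (by rw [eQ]; exact dQ)
  have sy := sh1 ty hty (by rw [ey]; exact dy)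
  have sg := sh1 tg htg (by rw [eg]; exact dg)
  have c₀P := ct t₀ ht₀ tP htP s₀ sP (by rw [e₀, eP]; exact hc₀P) (by rw [e₀, eP]; exact dc₀P)
  have c₀Q := ct t₀ ht₀ tQ htQ s₀ sQ (by rw [e₀, eQ]; exact hc₀Q) (by rw [e₀, eQ]; exact dc₀Q)
  have cyP := ct ty hty tP htP sy sP (by rw [ey, eP]; exact hyP) (by rw [ey, eP]; exact dyP)
  have cyQ := ct ty hty tQ htQ sy sQ (by rw [ey, eQ]; exact hyQ) (by rw [ey, eQ]; exact dyQ)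
  have cgP := ct tg htg tP htP sg sP (by rw [eg, eP]; exact hgP) (by rw [eg, eP]; exact dgP)
  have cgQ := ct tg htg tQ htQ sg sQ (by rw [eg, eQ]; exact hgQ) (by rw [eg, eQ]; exact dgQ)
  have hPQ' : tP ≠ tQ := fun h => hPQ (by rw [← eP, ← eQ, h])
  -- three common contacts of (tP, tQ) in a set of at most two
  set CC := I.filter fun t => sqNormInt t = N ∧ 2 * dotInt t tP = N ∧ 2 * dotInt t tQ = N
  have hCC : CC.card ≤ 2 := hcc tP htP tQ htQ sP sQ hPQ'
  have m₀ : t₀ ∈ CC := Finset.mem_filter.2 ⟨ht₀, s₀, c₀P, c₀Q⟩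
  have my : ty ∈ CC := Finset.mem_filter.2 ⟨hty, sy, cyP, cyQ⟩
  have mg : tg ∈ CC := Finset.mem_filter.2 ⟨htg, sg, cgP, cgQ⟩
  have n₀y : t₀ ≠ ty := fun h => hc₀y (by rw [← e₀, ← ey, h])
  have n₀g : t₀ ≠ tg := fun h => hc₀g (by rw [← e₀, ← eg, h])
  by_contra hyg
  have nyg : ty ≠ tg := fun h => hyg (by rw [← ey, ← eg, h])
  have h3 : ({t₀, ty, tg} : Finset (Fin 3 → ℤ)).card = 3 := by
    rw [Finset.card_insert_of_notMem (by simp [n₀y, n₀g]), Finset.card_insert_of_notMem (by simp [nyg]), Finset.card_singleton]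
  have hsub : ({t₀, ty, tg} : Finset (Fin 3 → ℤ)) ⊆ CC := by
    intro t ht
    simp only [Finset.mem_insert, Finset.mem_singleton] at ht
    rcases ht with rfl | rfl | rfl <;> assumption
  have := Finset.card_le_card hsub
  omega

end Confusion

end Summit.AtomisticToContinuum.Crystallization.Theorems.ChartedZeroExcessLayeredLatticeLiouville
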